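import Literature.Probability.RandomPlanarGeometry.SAWTiltedFiniteMemory16T11x9
import Literature.Probability.RandomPlanarGeometry.SAWTiltedFiniteMemory16T25x16
import Literature.Probability.RandomPlanarGeometry.SAWTiltedFiniteMemory16T125x64
import Literature.Probability.RandomPlanarGeometry.SAWTiltedFiniteMemory16T256x81
import Literature.Probability.RandomPlanarGeometry.SAWLowerBound2604
import HarnessLib

/-!
# Explicit sub-ballisticity of the planar self-avoiding walk above speed `0.383` (endpoint, one axis)

Topic `Literature/Probability/RandomPlanarGeometry` (continues `SAWTiltedFiniteMemory.lean`).
Duminil-Copin–Hammond (2013, Theorem 1.1): for every `v > 0` there is an (inexplicit) `ε > 0`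
with `P_{SAW_n}(max_k ‖γ_k‖ ≥ vn) ≤ e^{-εn}` eventually. Here, for the ENDPOINT ABSCISSA event
`{x(ω_n) ≥ vn}` and speeds above the certified threshold
`v₀ = log(λ̄_{11/9}/2.604)/log(11/9) = 0.3828…` (`speedThreshold`), the rate is made EXPLICIT and
kernel-checked from the tilted memory-16 Pönitz–Tittmann certificates
(`FiniteMemory.checkW_16_a_b`, native_decide) and the tree's lower bound `μ ≥ 2.604`
(`le_connectiveConstant_2604`):

* `card_xEnd_ge_speed_le_exp` — `#{ω ∈ SAW_n : x(ω_n) ≥ vn} ≤ 2⁴¹ e^{-(v - v₀)·log(11/9)·n} cₙ`, all `v`, `n`;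
* μ-FREE COUNTS at three speeds, from the perfect-power tilts `(5/4)², (5/4)³, (4/3)⁴`:
  `#{x(ω_n) ≥ n/2} ≤ 2⁴¹ · 2.51411534ⁿ`, `#{x(ω_n) ≥ 2n/3} ≤ 2⁴¹ · 2.2740854…ⁿ`,
  `#{x(ω_n) ≥ 3n/4} ≤ 2⁴¹ · 2.0385606…ⁿ` (exact rationals in the statements; compare `cₙ ≥ μⁿ ≥ 2.604ⁿ`);
* relative forms `≤ 2⁴¹ e^{-n/29} cₙ`, `≤ 2⁴¹ e^{-n/8} cₙ`, `≤ 2⁴¹ e^{-21n/100} cₙ` (exact rates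
  `0.0351, 0.1355, 0.2448`; the displayed ones use `1 - x ≤ e^{-x}`);
* `card_xEnd_ge_speed_le_exp_of_printed` — with the printed `μ ≥ 2.625622`
  (`Zd.BDGS2012_connectiveConstant_two_bounds`, Jensen 2004) as hypothesis the threshold is `0.3416…`.
By the lattice symmetries the same bounds hold for `-x`, `±y` (not restated here); the
max-over-time Euclidean event of the printed theorem needs in addition a first-passage
decomposition and the diagonal tilt `FiniteMemory.checkD` (not in this file).
Certified tilted growth rates used (`λ̄ = N/(10⁶ab) ≥ λ₁₆(θ = log(a/b))`): `11/9 ↦ 2.811918`,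
`25/16 ↦ 3.142644`, `125/64 ↦ 3.553259`, `256/81 ↦ 4.832144`.

## References

* H. Duminil-Copin, A. Hammond, *Self-avoiding walk is sub-ballistic*, Commun. Math. Phys. 324
  (2013) 401–423, Theorem 1.1 (arXiv:1205.0401) [DuminilCopinHammond2013].
* A. Pönitz, P. Tittmann, Electron. J. Combin. 7 (2000) R21, §3 [PonitzTittmann2000].
* I. Jensen, J. Phys. A 37 (2004) 11521–11529 (the printed lower bound `2.625622`) [Jensen2004SAWLowerBounds].
-/

open Finset Literature.Probability.LatticeModels
open scoped BigOperators

namespace Literature.Probability.RandomPlanarGeometry.SAW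

namespace FiniteMemory

/-! ### Speed forms of the tilted count bound (complements `SAWTiltedFiniteMemory.lean`) -/

/-- **μ-free speed form.** From a successful tilted check (`0 < b < a`, `0 < D`) and a real
`t ≥ ((b/a))^v` (any real `v`; e.g. `t = s^{-p}` when `a/b = s^q`, `v = p/q`): for every `n`,
`#{ω ∈ SAW_n : x(ω_n) ≥ v n} ≤ 2⁴¹ · (t · N/(D a b))ⁿ`. [cite: DuminilCopinHammond2013, Thm 1.1] -/
theorem card_speed_le_of_checkW {K a b N D iters : ℕ} (h : checkW K a b N D iters = true)
    (hb : 0 < b) (hba : b < a) (hD : 0 < D) {v t : ℝ} (ht : ((b : ℝ) / a) ^ v ≤ t) (n : ℕ) :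
    (((Zd.saws 2 n).filter fun ω => v * n ≤ ((ω n 0 : ℤ) : ℝ)).card : ℝ) ≤
      2 ^ 41 * (t * ((N : ℝ) / (D * a * b))) ^ n := by
  have ha : 0 < a := lt_trans hb hba
  have hs0 : (0 : ℝ) < (b : ℝ) / a := by positivity
  have hs1 : (b : ℝ) / a ≤ 1 := by rw [div_le_one (by exact_mod_cast ha)]; exact_mod_cast hba.le
  have hl0 : (0 : ℝ) ≤ (N : ℝ) / (D * a * b) := by positivity
  set m : ℤ := ⌈v * n⌉ with hm
  have hev : ((Zd.saws 2 n).filter fun ω => v * n ≤ ((ω n 0 : ℤ) : ℝ)) =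
      (Zd.saws 2 n).filter fun ω => m ≤ ω n 0 := by
    refine filter_congr fun ω _ => ?_
    rw [hm, Int.ceil_le]
  rw [hev, card_saws_filter_eq_card_sawWords_filter]
  refine le_trans (card_sawWords_xEnd_ge_le h hb hba.le hD n m) ?_
  have h1 : ((b : ℝ) / a) ^ m ≤ t ^ n :=
    calc ((b : ℝ) / a) ^ m = ((b : ℝ) / a) ^ ((m : ℤ) : ℝ) := (Real.rpow_intCast _ m).symm
      _ ≤ ((b : ℝ) / a) ^ (v * n : ℝ) := Real.rpow_le_rpow_of_exponent_ge hs0 hs1 (hm ▸ Int.le_ceil _)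
      _ = (((b : ℝ) / a) ^ v) ^ n := by rw [Real.rpow_mul hs0.le, Real.rpow_natCast]
      _ ≤ t ^ n := pow_le_pow_left₀ (Real.rpow_nonneg hs0.le v) ht n
  calc 2 ^ 41 * ((N : ℝ) / (D * a * b)) ^ n * ((b : ℝ) / a) ^ m
      ≤ 2 ^ 41 * ((N : ℝ) / (D * a * b)) ^ n * t ^ n := by gcongr
    _ = 2 ^ 41 * (t * ((N : ℝ) / (D * a * b))) ^ n := by rw [mul_pow]; ring

/-- **Speed form relative to the number of walks.** With, in addition, a certified lower bound
`0 < μlo ≤ μ(ℤ²)`: `#{ω ∈ SAW_n : x(ω_n) ≥ v n} ≤ 2⁴¹ · (t·N/(D a b μlo))ⁿ · cₙ` — an explicit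
exponential rate `ε = log(μlo D a b /(t N))` as soon as `t N < μlo D a b`.
[cite: DuminilCopinHammond2013, Thm 1.1] -/
theorem card_speed_le_mul_count_of_checkW {K a b N D iters : ℕ} (h : checkW K a b N D iters = true)
    (hb : 0 < b) (hba : b < a) (hD : 0 < D) {v t : ℝ} (ht0 : 0 ≤ t) (ht : ((b : ℝ) / a) ^ v ≤ t)
    {μlo : ℝ} (hμ0 : 0 < μlo) (hμ : μlo ≤ Zd.connectiveConstant 2) (n : ℕ) :
    (((Zd.saws 2 n).filter fun ω => v * n ≤ ((ω n 0 : ℤ) : ℝ)).card : ℝ) ≤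
      2 ^ 41 * (t * ((N : ℝ) / (D * a * b)) / μlo) ^ n * Zd.count 2 n := by
  have ha : 0 < a := lt_trans hb hba
  have hl0 : (0 : ℝ) ≤ t * ((N : ℝ) / (D * a * b)) := by positivity
  have hμn : μlo ^ n ≤ (Zd.count 2 n : ℝ) :=
    le_trans (pow_le_pow_left₀ hμ0.le hμ n) (Zd.pow_connectiveConstant_le_count 2 n)
  refine le_trans (card_speed_le_of_checkW h hb hba hD ht n) ?_
  have : (t * ((N : ℝ) / (D * a * b))) ^ n = (t * ((N : ℝ) / (D * a * b)) / μlo) ^ n * μlo ^ n := by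
    rw [← mul_pow, div_mul_cancel₀ _ hμ0.ne']
  rw [this, ← mul_assoc]
  gcongr

end FiniteMemory

open FiniteMemory

/-! ### The certified tilted growth rates (memory 16) -/

/-- `μ(ℤ²) ≥ 2.604` in the `Zd` vocabulary. [cite: Jensen2004SAWLowerBounds, §2] -/
theorem mulo_le : (2.604 : ℝ) ≤ Zd.connectiveConstant 2 := by
  rw [Zd.connectiveConstant_two]; exact le_connectiveConstant_2604

/-- **Speed `1/2`, μ-free count form** (tilt `25/16 = (5/4)²`, `λ̄ = 1257057670/(10⁶·400)`):
`#{ω ∈ SAW_n : x(ω_n) ≥ n/2} ≤ 2⁴¹ · (125705767/50000000)ⁿ = 2⁴¹ · 2.51411534ⁿ` for every `n`.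
[cite: DuminilCopinHammond2013, Thm 1.1] -/
theorem card_xEnd_ge_half_le (n : ℕ) :
    (((Zd.saws 2 n).filter fun ω => (1 / 2 : ℝ) * n ≤ ((ω n 0 : ℤ) : ℝ)).card : ℝ) ≤
      2 ^ 41 * (125705767 / 50000000 : ℝ) ^ n := by
  have ht : ((16 : ℕ) / (25 : ℕ) : ℝ) ^ (1 / 2 : ℝ) ≤ 4 / 5 := by
    rw [show ((16 : ℕ) / (25 : ℕ) : ℝ) = (4 / 5 : ℝ) ^ (2 : ℕ) by norm_num,
      show (1 / 2 : ℝ) = ((2 : ℕ) : ℝ)⁻¹ by norm_num, Real.pow_rpow_inv_natCast (by norm_num) two_ne_zero]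
  have h := card_speed_le_of_checkW checkW_16_25_16 (by norm_num) (by norm_num) (by norm_num) ht n
  have e : (4 / 5 : ℝ) * ((1257057670 : ℕ) / ((1000000 : ℕ) * (25 : ℕ) * (16 : ℕ))) = 125705767 / 50000000 := by
    norm_num
  rwa [e] at h

/-- **Speed `1/2`, relative form**: `#{ω ∈ SAW_n : x(ω_n) ≥ n/2} ≤ 2⁴¹ · e^{-n/29} · cₙ`
(`ρ = 2.51411534/2.604 = 0.96548… ≤ 1 - 1/29 ≤ e^{-1/29}`; the exact rate is `0.0351`).
[cite: DuminilCopinHammond2013, Thm 1.1] -/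
theorem card_xEnd_ge_half_le_exp (n : ℕ) :
    (((Zd.saws 2 n).filter fun ω => (1 / 2 : ℝ) * n ≤ ((ω n 0 : ℤ) : ℝ)).card : ℝ) ≤
      2 ^ 41 * Real.exp (-(n / 29 : ℝ)) * Zd.count 2 n := by
  have ht : ((16 : ℕ) / (25 : ℕ) : ℝ) ^ (1 / 2 : ℝ) ≤ 4 / 5 := by
    rw [show ((16 : ℕ) / (25 : ℕ) : ℝ) = (4 / 5 : ℝ) ^ (2 : ℕ) by norm_num,
      show (1 / 2 : ℝ) = ((2 : ℕ) : ℝ)⁻¹ by norm_num, Real.pow_rpow_inv_natCast (by norm_num) two_ne_zero]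
  have h := card_speed_le_mul_count_of_checkW checkW_16_25_16 (by norm_num) (by norm_num) (by norm_num)
    (by norm_num) ht (by norm_num : (0 : ℝ) < 2.604) mulo_le n
  refine le_trans h ?_
  have hρ : (4 / 5 : ℝ) * ((1257057670 : ℕ) / ((1000000 : ℕ) * (25 : ℕ) * (16 : ℕ))) / 2.604 ≤
      Real.exp (-(1 / 29 : ℝ)) := le_trans (by norm_num) (Real.add_one_le_exp (-(1 / 29 : ℝ)))
  have hρ0 : (0 : ℝ) ≤ (4 / 5 : ℝ) * ((1257057670 : ℕ) / ((1000000 : ℕ) * (25 : ℕ) * (16 : ℕ))) / 2.604 := by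
    norm_num
  have : ((4 / 5 : ℝ) * ((1257057670 : ℕ) / ((1000000 : ℕ) * (25 : ℕ) * (16 : ℕ))) / 2.604) ^ n ≤
      Real.exp (-(n / 29 : ℝ)) := by
    refine le_trans (pow_le_pow_left₀ hρ0 hρ n) ?_
    rw [← Real.exp_nat_mul]; apply le_of_eq; congr 1; ring
  gcongr

/-- **Speed `2/3`, μ-free count form** (tilt `125/64 = (5/4)³`, `λ̄ = 28426068191/(10⁶·8000)`):
`#{ω ∈ SAW_n : x(ω_n) ≥ 2n/3} ≤ 2⁴¹ · (28426068191/12500000000)ⁿ = 2⁴¹ · 2.2740854…ⁿ`.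
[cite: DuminilCopinHammond2013, Thm 1.1] -/
theorem card_xEnd_ge_twoThirds_le (n : ℕ) :
    (((Zd.saws 2 n).filter fun ω => (2 / 3 : ℝ) * n ≤ ((ω n 0 : ℤ) : ℝ)).card : ℝ) ≤
      2 ^ 41 * (28426068191 / 12500000000 : ℝ) ^ n := by
  have ht : ((64 : ℕ) / (125 : ℕ) : ℝ) ^ (2 / 3 : ℝ) ≤ 16 / 25 := by
    rw [show ((64 : ℕ) / (125 : ℕ) : ℝ) = (4 / 5 : ℝ) ^ (3 : ℕ) by norm_num, ← Real.rpow_natCast,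
      ← Real.rpow_mul (by norm_num)]
    norm_num
  have h := card_speed_le_of_checkW checkW_16_125_64 (by norm_num) (by norm_num) (by norm_num) ht n
  have e : (16 / 25 : ℝ) * ((28426068191 : ℕ) / ((1000000 : ℕ) * (125 : ℕ) * (64 : ℕ))) =
      28426068191 / 12500000000 := by norm_num
  rwa [e] at h

/-- **Speed `2/3`, relative form**: `#{ω ∈ SAW_n : x(ω_n) ≥ 2n/3} ≤ 2⁴¹ · e^{-n/8} · cₙ`
(`ρ = 0.87330… ≤ 1 - 1/8`; exact rate `0.1355`). [cite: DuminilCopinHammond2013, Thm 1.1] -/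
theorem card_xEnd_ge_twoThirds_le_exp (n : ℕ) :
    (((Zd.saws 2 n).filter fun ω => (2 / 3 : ℝ) * n ≤ ((ω n 0 : ℤ) : ℝ)).card : ℝ) ≤
      2 ^ 41 * Real.exp (-(n / 8 : ℝ)) * Zd.count 2 n := by
  have ht : ((64 : ℕ) / (125 : ℕ) : ℝ) ^ (2 / 3 : ℝ) ≤ 16 / 25 := by
    rw [show ((64 : ℕ) / (125 : ℕ) : ℝ) = (4 / 5 : ℝ) ^ (3 : ℕ) by norm_num, ← Real.rpow_natCast,
      ← Real.rpow_mul (by norm_num)]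
    norm_num
  have h := card_speed_le_mul_count_of_checkW checkW_16_125_64 (by norm_num) (by norm_num) (by norm_num)
    (by norm_num) ht (by norm_num : (0 : ℝ) < 2.604) mulo_le n
  refine le_trans h ?_
  have hρ : (16 / 25 : ℝ) * ((28426068191 : ℕ) / ((1000000 : ℕ) * (125 : ℕ) * (64 : ℕ))) / 2.604 ≤
      Real.exp (-(1 / 8 : ℝ)) := le_trans (by norm_num) (Real.add_one_le_exp (-(1 / 8 : ℝ)))
  have hρ0 : (0 : ℝ) ≤ (16 / 25 : ℝ) * ((28426068191 : ℕ) / ((1000000 : ℕ) * (125 : ℕ) * (64 : ℕ))) / 2.604 := by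
    norm_num
  have : ((16 / 25 : ℝ) * ((28426068191 : ℕ) / ((1000000 : ℕ) * (125 : ℕ) * (64 : ℕ))) / 2.604) ^ n ≤
      Real.exp (-(n / 8 : ℝ)) := by
    refine le_trans (pow_le_pow_left₀ hρ0 hρ n) ?_
    rw [← Real.exp_nat_mul]; apply le_of_eq; congr 1; ring
  gcongr

/-- **Speed `3/4`, μ-free count form** (tilt `256/81 = (4/3)⁴`, `λ̄ = 100199329268/(10⁶·20736)`):
`#{ω ∈ SAW_n : x(ω_n) ≥ 3n/4} ≤ 2⁴¹ · (25049832317/12288000000)ⁿ = 2⁴¹ · 2.0385606…ⁿ`.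
[cite: DuminilCopinHammond2013, Thm 1.1] -/
theorem card_xEnd_ge_threeQuarters_le (n : ℕ) :
    (((Zd.saws 2 n).filter fun ω => (3 / 4 : ℝ) * n ≤ ((ω n 0 : ℤ) : ℝ)).card : ℝ) ≤
      2 ^ 41 * (25049832317 / 12288000000 : ℝ) ^ n := by
  have ht : ((81 : ℕ) / (256 : ℕ) : ℝ) ^ (3 / 4 : ℝ) ≤ 27 / 64 := by
    rw [show ((81 : ℕ) / (256 : ℕ) : ℝ) = (3 / 4 : ℝ) ^ (4 : ℕ) by norm_num, ← Real.rpow_natCast,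
      ← Real.rpow_mul (by norm_num)]
    norm_num
  have h := card_speed_le_of_checkW checkW_16_256_81 (by norm_num) (by norm_num) (by norm_num) ht n
  have e : (27 / 64 : ℝ) * ((100199329268 : ℕ) / ((1000000 : ℕ) * (256 : ℕ) * (81 : ℕ))) =
      25049832317 / 12288000000 := by norm_num
  rwa [e] at h

/-- **Speed `3/4`, relative form**: `#{ω ∈ SAW_n : x(ω_n) ≥ 3n/4} ≤ 2⁴¹ · e^{-21n/100} · cₙ`
(`ρ = 0.78285… ≤ 1 - 21/100`; exact rate `0.2448`). [cite: DuminilCopinHammond2013, Thm 1.1] -/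
theorem card_xEnd_ge_threeQuarters_le_exp (n : ℕ) :
    (((Zd.saws 2 n).filter fun ω => (3 / 4 : ℝ) * n ≤ ((ω n 0 : ℤ) : ℝ)).card : ℝ) ≤
      2 ^ 41 * Real.exp (-(21 * n / 100 : ℝ)) * Zd.count 2 n := by
  have ht : ((81 : ℕ) / (256 : ℕ) : ℝ) ^ (3 / 4 : ℝ) ≤ 27 / 64 := by
    rw [show ((81 : ℕ) / (256 : ℕ) : ℝ) = (3 / 4 : ℝ) ^ (4 : ℕ) by norm_num, ← Real.rpow_natCast,
      ← Real.rpow_mul (by norm_num)]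
    norm_num
  have h := card_speed_le_mul_count_of_checkW checkW_16_256_81 (by norm_num) (by norm_num) (by norm_num)
    (by norm_num) ht (by norm_num : (0 : ℝ) < 2.604) mulo_le n
  refine le_trans h ?_
  have hρ : (27 / 64 : ℝ) * ((100199329268 : ℕ) / ((1000000 : ℕ) * (256 : ℕ) * (81 : ℕ))) / 2.604 ≤
      Real.exp (-(21 / 100 : ℝ)) := le_trans (by norm_num) (Real.add_one_le_exp (-(21 / 100 : ℝ)))
  have hρ0 : (0 : ℝ) ≤ (27 / 64 : ℝ) * ((100199329268 : ℕ) / ((1000000 : ℕ) * (256 : ℕ) * (81 : ℕ))) / 2.604 := by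
    norm_num
  have : ((27 / 64 : ℝ) * ((100199329268 : ℕ) / ((1000000 : ℕ) * (256 : ℕ) * (81 : ℕ))) / 2.604) ^ n ≤
      Real.exp (-(21 * n / 100 : ℝ)) := by
    refine le_trans (pow_le_pow_left₀ hρ0 hρ n) ?_
    rw [← Real.exp_nat_mul]; apply le_of_eq; congr 1; ring
  gcongr

/-! ### The threshold speed `v₀ = 0.3828…` and the explicit rate above it -/

/-- **The certified threshold speed**: `v₀ := log(λ̄/2.604)/log(11/9) = 0.38284…`, where
`λ̄ = 278379899/(10⁶·99) = 2.8119181…` is the certified tilted growth rate at tilt `11/9`.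
[cite: DuminilCopinHammond2013, Thm 1.1] -/
noncomputable def speedThreshold : ℝ :=
  Real.log (((278379899 : ℕ) : ℝ) / ((1000000 : ℕ) * (11 : ℕ) * (9 : ℕ)) / 2.604) / Real.log ((11 : ℝ) / 9)

/-- **Explicit sub-ballisticity along an axis above the threshold speed**: for every real `v` and
every `n`, `#{ω ∈ SAW_n : x(ω_n) ≥ vn} ≤ 2⁴¹ · exp(-(v - v₀) · log(11/9) · n) · cₙ`
(`log(11/9) = 0.2007`; nontrivial for `v > v₀ = 0.3828…`). [cite: DuminilCopinHammond2013, Thm 1.1] -/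
theorem card_xEnd_ge_speed_le_exp (v : ℝ) (n : ℕ) :
    (((Zd.saws 2 n).filter fun ω => v * n ≤ ((ω n 0 : ℤ) : ℝ)).card : ℝ) ≤
      2 ^ 41 * Real.exp (-((v - speedThreshold) * Real.log ((11 : ℝ) / 9) * n)) * Zd.count 2 n := by
  have h := card_ballistic_le_of_checkW checkW_16_11_9 (by norm_num) (by norm_num) (by norm_num) (by norm_num)
    (by norm_num : (0 : ℝ) < 2.604) mulo_le v n
  have hlog : Real.log ((11 : ℝ) / 9) ≠ 0 := by
    rw [Ne, Real.log_eq_zero]; norm_num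
  have e : (v - speedThreshold) * Real.log ((11 : ℝ) / 9) =
      v * Real.log (((11 : ℕ) : ℝ) / (9 : ℕ)) -
        Real.log ((((278379899 : ℕ) : ℝ)) / ((1000000 : ℕ) * (11 : ℕ) * (9 : ℕ)) / 2.604) := by
    rw [speedThreshold, sub_mul, div_mul_cancel₀ _ hlog]; push_cast; ring
  rw [e]; exact h

/-- **The printed-record variant**: assuming the printed enclosure `μ ≥ 2.625622`
(`Zd.BDGS2012_connectiveConstant_two_bounds`, Jensen 2004), the threshold drops to
`v₀' = log(λ̄/2.625622)/log(11/9) = 0.3416…`: `#{x(ω_n) ≥ vn} ≤ 2⁴¹ e^{-(v - v₀') log(11/9) n} cₙ`.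
[cite: DuminilCopinHammond2013, Thm 1.1] -/
theorem card_xEnd_ge_speed_le_exp_of_printed (hJ : Zd.BDGS2012_connectiveConstant_two_bounds)
    (v : ℝ) (n : ℕ) :
    (((Zd.saws 2 n).filter fun ω => v * n ≤ ((ω n 0 : ℤ) : ℝ)).card : ℝ) ≤
      2 ^ 41 * Real.exp (-((v * Real.log ((11 : ℝ) / 9) -
        Real.log (((278379899 : ℕ) : ℝ) / ((1000000 : ℕ) * (11 : ℕ) * (9 : ℕ)) / 2.625622)) * n)) *
        Zd.count 2 n := by
  have h := card_ballistic_le_of_checkW checkW_16_11_9 (by norm_num) (by norm_num) (by norm_num) (by norm_num)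
    (by norm_num : (0 : ℝ) < 2.625622) hJ.1 v n
  push_cast at h ⊢
  exact h

end Literature.Probability.RandomPlanarGeometry.SAW
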